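import Mathlib
import Summits.NavierStokesRegularity.NavierStokesRegularity.Theorems.EulerZoomLiouvillePowerGaugeEulerLiouvilleBirthDefsFour
import Summits.NavierStokesRegularity.NavierStokesRegularity.Theorems.EulerZoomLiouvillePowerGaugeEulerLiouvilleSpiralEndgame
import Summits.NavierStokesRegularity.NavierStokesRegularity.Theorems.EulerZoomLiouvillePowerGaugeEulerLiouvilleSpiralLocData
import HarnessLib

/-!
# Crux `EulerZoomLiouville.PowerGaugeEulerLiouville` (stmt-NavierStokesRegularity-19832), line `relative_equilibria` (ns-idea-11):
# THE SUB-EXTREMAL SPIRAL STRATUM IS EMPTY IN THE CLASS (member R3, by name — the LEAD's binder `¬ IsPastSpiralSubExtremal ρ u`)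

Route `EulerZoomLiouville` (NavierStokesRegularity), crux E; LEAD ns-typeII-p2 g17 (R3a-MEM of the R3a wave keyed 2026-08-29T14:00Z).
COMPOSITION ONLY: the spiral dictionary `Spiral.exists_locData_of_pastSpiral` (R3a = bricks P2–P7 of the port recipe
`Cruxes/PowerGaugeEulerLiouville/Lines/relative-equilibria.md`: ns-idea-11 g11/g12, ns-ezl-w1 g10, ns-sfl-p1 g11, ns-ezl-w2 g8,
ns-ezl-w3 g9; assembly ns-ezl-w1 g10) ∘ the radial Bronzi–Shvydkoy endgame `Spiral.pastSpiral_trivial_of_locData_of_subExtremal`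
(`…SpiralEndgame`, LEAD g17 p724254), stated with the binder predicate `IsPastSpiralSubExtremal` of `…BirthDefsFour` (p725060):

* `Spiral.pastSpiralSubExtremal_trivial` — crux hypotheses verbatim (`0 < ρ ≤ ½`, `InClass ρ u p H c`) and
  `IsPastSpiralSubExtremal ρ u` (the velocity is a Perelman spiral `u(τ,x) = (T−τ)^{γ−1} e^{(log(T−τ))S} V(e^{−(log(T−τ))S}(T−τ)^{−γ}(x−x₀))`
  about some `(T, x₀)` with a skew generator `S` for `τ < T₁ ≤ min 0 T`, `γ = 1/(2+ρ)`, and the profile energy is sub-extremal,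
  `liminf_{L→∞} L^{2ρ−1}∫_{B_L}|V|² = 0`) ⇒ `u = 0` a.e. on `(−∞,0) × ℝ³`.

`S = 0` is the tree's `Past.selfSimilar_ae_eq_zero_of_subExtremal_past` (binder `IsPastSelfSimilarSubExtremal`, first disjunct).
This is the member the LEAD skeleton v118 wires as the filled stub `stub_pastSpiralSubExtremal`.  WHAT THIS IS NOT: not NS, not E,
not a reduction of the three open stubs — one more SYMMETRY stratum (relative similarity equilibria, O(3)-twisted) of the OPEN crux
class; `--supports` stmt-19832.  [folklore; cf. BronziShvydkoy2015 Thm 1.1]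
-/

noncomputable section

-- flat `Theorems/<Route><Decl>…` files of one crux share the namespace of the crux (tree convention: `Summit.<S>.<S>.…`)
set_option linter.dupNamespace false

open MeasureTheory Set Filter Topology Metric Function TopologicalSpace
open scoped ENNReal NNReal RealInnerProductSpace

namespace Summit.NavierStokesRegularity.NavierStokesRegularity.Theorems.PowerGaugeEulerLiouville

open Literature.Analysis Literature.Analysis.FluidPDE Literature.Analysis.FunctionSpaces
open Summit.NavierStokesRegularity.NavierStokesRegularity.Theorems.PowerGaugeEulerLiouville.Birth

namespace Spiral

/-- **No sub-extremal SPIRAL (O(3)-twisted self-similar) Euler collapse in Seregin's power-gauged class, about any point, even only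
in the past** (line `relative_equilibria` R3, member level; crux hypotheses verbatim, `0 < ρ ≤ ½`): a member whose velocity is a
Perelman spiral about `(T, x₀)` with skew generator `S` and profile `V` for `τ < T₁` (`T₁ ≤ 0`, `T₁ ≤ T`) and whose profile energy is
sub-extremal (`liminf_{L→∞} L^{2ρ−1}∫_{B_L}|V|² = 0`) vanishes a.e. on `(−∞,0) × ℝ³`.  Equivalently a nontrivial spiral member
SATURATES the `A`-gauge.  Spiral dictionary (R3a, `Spiral.exists_locData_of_pastSpiral`) ∘ radial energy-saturation endgame
(`Spiral.pastSpiral_trivial_of_locData_of_subExtremal`). [folklore; cf. BronziShvydkoy2015 Thm 1.1] -/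
theorem pastSpiralSubExtremal_trivial {ρ : ℝ} (hρ : 0 < ρ) (hρh : ρ ≤ 1 / 2)
    {u : ℝ → E3 → E3} {p : ℝ → E3 → ℝ} {H : ℝ → E3 → E3 →L[ℝ] E3} {c : ℝ≥0}
    (h : InClass ρ u p H c) (hS : IsPastSpiralSubExtremal ρ u) :
    Function.uncurry u =ᵐ[volume.restrict (Set.Iio (0 : ℝ) ×ˢ (Set.univ : Set E3))] 0 := by
  obtain ⟨T, T₁, x₀, S, V, hT₁, hTT₁, hSk, hsp, hsub⟩ := hS
  obtain ⟨P, G, c', hloc⟩ := Spiral.exists_locData_of_pastSpiral hρ hρh h hT₁ hTT₁ hSk hsp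
  exact Spiral.pastSpiral_trivial_of_locData_of_subExtremal hρ hρh hTT₁ h.1 h.2.1 h.2.2 hSk hsp ⟨P, G, c', hloc⟩ hsub

end Spiral

end Summit.NavierStokesRegularity.NavierStokesRegularity.Theorems.PowerGaugeEulerLiouville
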